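import Mathlib.NumberTheory.NumberField.InfinitePlace.Embeddings
import Mathlib.RingTheory.Norm.Transitivity
import HarnessLib

/-!
# The relative norm of a totally positive element is totally positive

Topic `NumberTheory/NumberFields`; namespace `Literature.NumberTheory.NumberFields`.  Theorems
only, fully proved.

For a finite extension of number fields `E/F`, a nonzero `x ∈ E` positive at every real
embedding of `E`, and a real embedding `ρ` of `F`:
`ρ(N_{E/F}(x)) = ∏_{σ : E → ℂ over ρ} σ(x)` (Mathlib `Algebra.norm_eq_prod_embeddings`); the
real `σ` contribute `σ(x) > 0` and the complex ones come in conjugate pairs `σ, σ̄` contributing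
`|σ(x)|² > 0`, so `ρ(N_{E/F}(x)) = ∏_σ |σ(x)| > 0` (`embedding_norm_pos_of_totallyPositive`).  The
pairing is organised through Mathlib's `Finset.prod_involution` applied to the phases
`σ(x)/|σ(x)|` (a real `σ`, i.e. one fixed by conjugation, is `NumberField.ComplexEmbedding.IsReal`
and factors through its `IsReal.embedding : E →+* ℝ`).  This is the archimedean half of "norms of
ray elements are ray elements" (`N_{E/F}(α) ≫ 0` for `α ≫ 0`, Childress, *Class Field Theory*,
Ch. 5 §2, proof of Prop. 2.2, PDF p. 125: "`N_{E_i/F}(α_{E_i}) ≫ 0`"), used in Artin's proof of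
the reciprocity law.

## References

* N. Childress, *Class Field Theory*, Universitext, Springer 2009, Ch. 5 §2, proof of Prop. 2.2
  (PDF p. 125). [Childress2009]
-/

noncomputable section

open NumberField Complex

open scoped ComplexConjugate

namespace Literature.NumberTheory.NumberFields

variable {F E : Type*} [Field F] [NumberField F] [Field E] [NumberField E] [Algebra F E]

/-- **`N_{E/F}` of a totally positive element is positive at every real embedding of `F`.**
For `x ∈ E` nonzero with `τ(x) > 0` for every real embedding `τ` of `E` and a real embedding `ρ`
of `F`, `ρ(N_{E/F} x) = ∏_σ |σ x| > 0`, the product over the `F`-embeddings `σ : E → ℂ` above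
`ρ`: the phases `σ(x)/|σ(x)|` cancel in conjugate pairs and equal `1` at real `σ`.
[cite: Childress2009, Ch. 5 §2, proof of Prop. 2.2 (PDF p. 125)] -/
theorem embedding_norm_pos_of_totallyPositive {x : E} (hx0 : x ≠ 0)
    (hx : ∀ τ : E →+* ℝ, 0 < τ x) (ρ : F →+* ℝ) : 0 < ρ (Algebra.norm F x) := by
  classical
  letI : Algebra F ℂ := (ofRealHom.comp ρ).toAlgebra
  have halg : ∀ c : F, algebraMap F ℂ c = ((ρ c : ℝ) : ℂ) := fun c => rfl
  -- `ρ (N x) = ∏ σ x`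
  have hprod : ((ρ (Algebra.norm F x) : ℝ) : ℂ) = ∏ σ : E →ₐ[F] ℂ, σ x := by
    rw [← halg]
    exact Algebra.norm_eq_prod_embeddings F ℂ x
  have hσ0 : ∀ σ : E →ₐ[F] ℂ, σ x ≠ 0 := fun σ =>
    (map_ne_zero_iff _ (σ : E →+* ℂ).injective).mpr hx0
  -- the phases `u σ = σ x / |σ x|` multiply to `1`
  set u : (E →ₐ[F] ℂ) → ℂ := fun σ => σ x / (‖σ x‖ : ℂ) with hu
  have hnorm0 : ∀ σ : E →ₐ[F] ℂ, ((‖σ x‖ : ℝ) : ℂ) ≠ 0 := fun σ =>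
    ofReal_ne_zero.mpr (norm_ne_zero_iff.mpr (hσ0 σ))
  -- complex conjugation on the `F`-embeddings (`ρ(F) ⊆ ℝ`)
  let cj : (E →ₐ[F] ℂ) → (E →ₐ[F] ℂ) := fun σ =>
    { ComplexEmbedding.conjugate (σ : E →+* ℂ) with
      commutes' := fun c => by
        change conj (σ (algebraMap F E c)) = algebraMap F ℂ c
        rw [σ.commutes, halg, conj_ofReal] }
  have hcj : ∀ (σ : E →ₐ[F] ℂ) (y : E), cj σ y = conj (σ y) := fun σ y => rfl
  have hreal : ∀ σ : E →ₐ[F] ℂ, cj σ = σ → u σ = 1 := by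
    intro σ hσ
    have hR : ComplexEmbedding.IsReal (σ : E →+* ℂ) := by
      rw [ComplexEmbedding.isReal_iff]
      exact congrArg (fun φ : E →ₐ[F] ℂ => (φ : E →+* ℂ)) hσ
    have h1 : σ x = ((hR.embedding x : ℝ) : ℂ) := (hR.coe_embedding_apply x).symm
    have hpos : 0 < hR.embedding x := hx _
    rw [hu]
    simp only
    rw [h1, Complex.norm_real, Real.norm_of_nonneg hpos.le, div_self]
    exact ofReal_ne_zero.mpr hpos.ne'
  have hone : ∏ σ : E →ₐ[F] ℂ, u σ = 1 := by
    refine Finset.prod_involution (fun σ _ => cj σ) ?_ ?_ (fun σ _ => Finset.mem_univ _) ?_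
    · intro σ _
      rw [hu]
      simp only
      rw [hcj, norm_conj, div_mul_div_comm, mul_conj, normSq_eq_norm_sq, ofReal_pow, sq,
        div_self (mul_ne_zero (hnorm0 σ) (hnorm0 σ))]
    · intro σ _ hσ heq
      exact hσ (hreal σ heq)
    · intro σ _
      apply AlgHom.ext
      intro y
      rw [hcj, hcj]
      exact conj_conj _
  -- hence `ρ (N x) = ∏ |σ x| > 0`
  have hprod2 : ∏ σ : E →ₐ[F] ℂ, σ x = ∏ σ : E →ₐ[F] ℂ, ((‖σ x‖ : ℝ) : ℂ) := by
    have h3 : ∀ σ : E →ₐ[F] ℂ, σ x = ((‖σ x‖ : ℝ) : ℂ) * u σ := fun σ => by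
      rw [hu]
      simp only
      rw [mul_div_cancel₀ _ (hnorm0 σ)]
    rw [Finset.prod_congr rfl fun σ _ => h3 σ, Finset.prod_mul_distrib, hone, mul_one]
  have h4 : ρ (Algebra.norm F x) = ∏ σ : E →ₐ[F] ℂ, ‖σ x‖ := by
    apply ofReal_injective
    rw [hprod, hprod2, ofReal_prod]
  rw [h4]
  exact Finset.prod_pos fun σ _ => norm_pos_iff.mpr (hσ0 σ)

/-- **`N_{E/F}` of a totally positive element is totally positive**, for `x ∈ Eˣ`.
[cite: Childress2009, Ch. 5 §2, proof of Prop. 2.2 (PDF p. 125)] -/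
theorem totallyPositive_norm (x : Eˣ) (hx : ∀ τ : E →+* ℝ, 0 < τ x) (ρ : F →+* ℝ) :
    0 < ρ (Units.map (Algebra.norm F : E →* F) x : F) :=
  embedding_norm_pos_of_totallyPositive x.ne_zero hx ρ

end Literature.NumberTheory.NumberFields
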